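import Mathlib
import HarnessLib
import HarnessLib.Audit
import Summits.CriticalPhenomena.PercolationContinuityZ3.Theorems.PercNearOneGluingNoHeavyLowerTailHexMSMatch
import Summits.CriticalPhenomena.PercolationContinuityZ3.Theorems.PercNearOneGluingNoHeavyLowerTailHexMSDeadMatching
import Summits.CriticalPhenomena.PercolationContinuityZ3.Theorems.PercNearOneGluingNoHeavyLowerTailDeltaMS

/-!
# Conjecture (MATCH): reduction to complement-closed dead sets, and the two-adjacent-axes case (hp-7 gen 69)

Support file for crux `stmt-CriticalPhenomena-4575` (route `PercNearOneGluingNoHeavy`), hull-port seat `prim-hp-7` (generation 69);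
`--supports stmt-CriticalPhenomena-4575`.  No `sorry`.  Memo: `run/shared/lean/prim/prim-hp-7/FROM-prim-hp-7-g69-MATCH-SYMMETRIC.md`.

Vocabulary of `…HexMSMatch` (gen 67): in an antipodal instance `(U, 𝒟, x)` a member `s` is DEAD if it is not a far meet/join
(`s ∉ symGen U 𝒟 x`); its CANDIDATES are its absent far products `farProducts 𝒟 x s \ 𝒟`; Conjecture (MATCH) = `MatchHall U 𝒟 x` is Hall's
condition `#A ≤ #(⋃_{s ∈ A} candidates s)` for every set `A` of dead members ((MATCH) ⟹ Δ-HEX ⟹ HEX-MS, `deltaHexRel_of_matchHall`).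

* `farProducts_compl`, `candidates_compl` — the bipartite graph dead ↔ candidates is symmetric under complementation in `U`:
  the candidates of `U \ s` are the complements of the candidates of `s`; `compl_mem_dead` — so is the dead set.
* `matchHall_of_complClosed`, `matchHall_iff_complClosed` — **(MATCH) ⟺ Hall's condition for the COMPLEMENT-CLOSED dead sets only.**
  (For an arbitrary dead `A` with complement-image `Aᶜ`: `N(Aᶜ) = N(A)ᶜ`, so `2 #N(A) = #N(A ∪ Aᶜ) + #(N(A) ∩ N(A)ᶜ) ≥ #(A ∪ Aᶜ) + #(A ∩ Aᶜ) = 2 #A`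
  by the two symmetric instances of Hall's condition.)  For a complement-closed dead `A` the neighbourhood is simply
  `(all far products with a factor in A) \ 𝒟`, so (MATCH) reads: **every complement-closed family `A` of dead members has at least `#A` absent
  far products** — a 'relative Δ-HEX' (for an all-dead instance and `A = 𝒟` it is Δ-HEX itself).
* `sdiff_mem_candidates_of_twoAxes`, `matchHall_of_adjacent` — **(MATCH) holds for every instance whose labels lie on at most two ADJACENT
  antipodal axes** (`x a ∈ {i, i+1, i+3, i+4}` on `𝒟`): for dead `b, b'` with labels in `{i, i+1}` the difference `b \ b'` and the complement
  `U \ (b' \ b)` are candidates of `b` (a member equal to `b \ b'` would have to be close to `x b` and far from `x b'`, impossible with four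
  labels), so a complement-closed dead `A = B ∪ Bᶜ` has at least `#(B \\ B ∪ (B \\ B)ᶜ) ≥ 2 #B = #A` candidates by Δ-MS
  (`two_mul_card_le_card_cl_diffs`, gen 66).  Three axes remain open (gen 69 memo: exact n ≤ 6, and the blocker/compensation structure).
-/

namespace Summit.CriticalPhenomena.PercolationContinuityZ3.Theorems

namespace GeneratedDonors

open Finset FinsetFamily

variable {α : Type*} [DecidableEq α]
variable {U : Finset α} {𝒟 : Finset (Finset α)} {x : Finset α → ZMod 6}

section ComplementSymmetry

/-- Of two antipodal labels exactly one is close to a given label. -/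
theorem close_add_three_iff_not_close (s t : ZMod 6) : Close (s + 3) t ↔ ¬ Close s t := by
  revert s t; decide

/-- Complement of a meet inside `U`. -/
theorem compl_inter_eq_compl_sdiff_union (U s d : Finset α) : (U \ s) ∩ d = U \ (s ∪ (U \ d)) := by
  ext i
  simp only [mem_inter, mem_sdiff, mem_union]
  tauto

/-- Complement of a join inside `U` (for `d ⊆ U`). -/
theorem compl_union_eq_compl_sdiff_inter {U d : Finset α} (s : Finset α) (hd : d ⊆ U) :
    (U \ s) ∪ d = U \ (s ∩ (U \ d)) := by
  ext i
  simp only [mem_inter, mem_sdiff, mem_union]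
  have := @hd i
  tauto

/-- Far products of a member lie inside the ground set. -/
theorem farProducts_subset_ground (hU : ∀ a ∈ 𝒟, a ⊆ U) {s : Finset α} (hs : s ∈ 𝒟) {p : Finset α}
    (hp : p ∈ farProducts 𝒟 x s) : p ⊆ U := by
  obtain ⟨d, hd, -, rfl | rfl⟩ := mem_farProducts.mp hp
  · exact inter_subset_left.trans (hU s hs)
  · exact union_subset (hU s hs) (hU d hd)

/-- **The far products of `U \ s` are the complements of the far products of `s`.**  (`d` is far from `U \ s` iff `U \ d` is far from
`s`, and `(U \ s) ∩ d = U \ (s ∪ (U \ d))`, `(U \ s) ∪ d = U \ (s ∩ (U \ d))`.) -/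
theorem farProducts_compl (hU : ∀ a ∈ 𝒟, a ⊆ U) (hco : ∀ a ∈ 𝒟, U \ a ∈ 𝒟)
    (hanti : ∀ a ∈ 𝒟, x (U \ a) = x a + 3) {s : Finset α} (hs : s ∈ 𝒟) :
    farProducts 𝒟 x (U \ s) = (farProducts 𝒟 x s).image fun p => U \ p := by
  ext p
  rw [mem_image, mem_farProducts]
  constructor
  · rintro ⟨d, hd, hfar, hp⟩
    have hdU : U \ (U \ d) = d := Finset.sdiff_sdiff_eq_self (hU d hd)
    -- U \ d is far from s
    have hfar' : ¬ Close (x s) (x (U \ d)) := by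
      rw [hanti d hd, close_comm, close_add_three_iff_not_close, close_comm, not_not]
      rw [hanti s hs, close_add_three_iff_not_close, not_not] at hfar
      exact hfar
    rcases hp with rfl | rfl
    · refine ⟨s ∪ (U \ d), mem_farProducts.mpr ⟨U \ d, hco d hd, hfar', Or.inr rfl⟩, ?_⟩
      exact (compl_inter_eq_compl_sdiff_union U s d).symm
    · refine ⟨s ∩ (U \ d), mem_farProducts.mpr ⟨U \ d, hco d hd, hfar', Or.inl rfl⟩, ?_⟩
      exact (compl_union_eq_compl_sdiff_inter s (hU d hd)).symm
  · rintro ⟨q, hq, rfl⟩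
    obtain ⟨d, hd, hfar, rfl | rfl⟩ := mem_farProducts.mp hq
    · -- U \ (s ∩ d) = (U \ s) ∪ (U \ d)
      refine ⟨U \ d, hco d hd, ?_, Or.inr ?_⟩
      · rw [hanti s hs, hanti d hd, close_add_three_iff]; exact hfar
      · rw [compl_union_eq_compl_sdiff_inter s sdiff_subset, Finset.sdiff_sdiff_eq_self (hU d hd)]
    · refine ⟨U \ d, hco d hd, ?_, Or.inl ?_⟩
      · rw [hanti s hs, hanti d hd, close_add_three_iff]; exact hfar
      · rw [compl_inter_eq_compl_sdiff_union U s (U \ d), Finset.sdiff_sdiff_eq_self (hU d hd)]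

/-- **The candidates of `U \ s` are the complements of the candidates of `s`.** -/
theorem candidates_compl (hU : ∀ a ∈ 𝒟, a ⊆ U) (hco : ∀ a ∈ 𝒟, U \ a ∈ 𝒟)
    (hanti : ∀ a ∈ 𝒟, x (U \ a) = x a + 3) {s : Finset α} (hs : s ∈ 𝒟) :
    candidates 𝒟 x (U \ s) = (candidates 𝒟 x s).image fun p => U \ p := by
  unfold candidates
  rw [farProducts_compl hU hco hanti hs]
  ext p
  simp only [mem_sdiff, mem_image]
  constructor
  · rintro ⟨⟨q, hq, rfl⟩, hpD⟩
    refine ⟨q, ⟨hq, fun hqD => hpD (hco q hqD)⟩, rfl⟩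
  · rintro ⟨q, ⟨hq, hqD⟩, rfl⟩
    refine ⟨⟨q, hq, rfl⟩, fun h => hqD ?_⟩
    have := hco _ h
    rwa [Finset.sdiff_sdiff_eq_self (farProducts_subset_ground hU hs hq)] at this

/-- The dead set is closed under complementation in `U`. -/
theorem compl_mem_dead (hU : ∀ a ∈ 𝒟, a ⊆ U) (hco : ∀ a ∈ 𝒟, U \ a ∈ 𝒟) {s : Finset α}
    (hs : s ∈ dead U 𝒟 x) : U \ s ∈ dead U 𝒟 x := by
  unfold dead at hs ⊢
  rw [mem_filter] at hs ⊢
  obtain ⟨hsD, hdead⟩ := hs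
  refine ⟨hco s hsD, fun h => hdead ?_⟩
  unfold symGen at h ⊢
  rw [mem_union] at h ⊢
  rcases h with h | h
  · exact Or.inr (mem_image.mpr ⟨U \ s, h, Finset.sdiff_sdiff_eq_self (hU s hsD)⟩)
  · obtain ⟨g, hg, hgs⟩ := mem_image.mp h
    have hgU : g ⊆ U := gen_subset_ground hU hg
    have : g = s := by
      have h1 := congrArg (fun t => U \ t) hgs
      simp only [Finset.sdiff_sdiff_eq_self hgU, Finset.sdiff_sdiff_eq_self (hU s hsD)] at h1
      exact h1
    rw [← this]; exact Or.inl hg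

/-- Candidates lie inside the ground set. -/
theorem candidates_subset_ground (hU : ∀ a ∈ 𝒟, a ⊆ U) {s : Finset α} (hs : s ∈ 𝒟) {p : Finset α}
    (hp : p ∈ candidates 𝒟 x s) : p ⊆ U := by
  unfold candidates at hp
  exact farProducts_subset_ground hU hs (mem_sdiff.mp hp).1

/-- **(MATCH) follows from Hall's condition for the complement-closed dead sets.**  If `#A ≤ #N(A)` for every complement-closed
family `A` of dead members, then it holds for every family of dead members. -/
theorem matchHall_of_complClosed (hU : ∀ a ∈ 𝒟, a ⊆ U) (hco : ∀ a ∈ 𝒟, U \ a ∈ 𝒟)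
    (hanti : ∀ a ∈ 𝒟, x (U \ a) = x a + 3)
    (h : ∀ A ⊆ dead U 𝒟 x, (∀ a ∈ A, U \ a ∈ A) → #A ≤ #(A.biUnion (candidates 𝒟 x))) :
    MatchHall U 𝒟 x := by
  classical
  intro A hA
  have hAD : ∀ a ∈ A, a ∈ 𝒟 := fun a ha => (mem_filter.mp (show a ∈ dead U 𝒟 x from hA ha)).1
  have hAU : ∀ a ∈ A, a ⊆ U := fun a ha => hU a (hAD a ha)
  set Ac : Finset (Finset α) := A.image fun a => U \ a with hAc_def
  have hAc : Ac ⊆ dead U 𝒟 x := by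
    intro b hb
    obtain ⟨a, ha, rfl⟩ := mem_image.mp hb
    exact compl_mem_dead hU hco (hA ha)
  have hcc : ∀ a : Finset α, a ⊆ U → U \ (U \ a) = a := fun a ha => Finset.sdiff_sdiff_eq_self ha
  -- the two complement-closed families A ∪ Ac and A ∩ Ac
  have hclosed₁ : ∀ a ∈ A ∪ Ac, U \ a ∈ A ∪ Ac := by
    intro a ha
    rw [mem_union] at ha ⊢
    rcases ha with ha | ha
    · exact Or.inr (mem_image_of_mem _ ha)
    · obtain ⟨b, hb, rfl⟩ := mem_image.mp ha
      rw [hcc b (hAU b hb)]; exact Or.inl hb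
  have hclosed₂ : ∀ a ∈ A ∩ Ac, U \ a ∈ A ∩ Ac := by
    intro a ha
    rw [mem_inter] at ha ⊢
    obtain ⟨ha₁, ha₂⟩ := ha
    obtain ⟨b, hb, rfl⟩ := mem_image.mp ha₂
    rw [hcc b (hAU b hb)]
    exact ⟨hb, mem_image.mpr ⟨U \ b, ha₁, hcc b (hAU b hb)⟩⟩
  have h₁ := h (A ∪ Ac) (union_subset hA hAc) hclosed₁
  have h₂ := h (A ∩ Ac) (inter_subset_left.trans hA) hclosed₂
  set P := A.biUnion (candidates 𝒟 x) with hP_def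
  set Q := Ac.biUnion (candidates 𝒟 x) with hQ_def
  -- Q is the complement image of P
  have hQP : Q = P.image fun p => U \ p := by
    rw [hQ_def, hAc_def, image_biUnion, hP_def, biUnion_image]
    apply biUnion_congr rfl
    intro a ha
    exact candidates_compl hU hco hanti (hAD a ha)
  have hPU : ∀ p ∈ P, p ⊆ U := by
    intro p hp
    obtain ⟨a, ha, hpa⟩ := mem_biUnion.mp hp
    exact candidates_subset_ground hU (hAD a ha) hpa
  have hinjP : Set.InjOn (fun p : Finset α => U \ p) ↑P := by
    intro p hp q hq hpq
    have h1 := congrArg (fun t => U \ t) hpq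
    simp only [hcc p (hPU p (mem_coe.mp hp)), hcc q (hPU q (mem_coe.mp hq))] at h1
    exact h1
  have hcardQ : #Q = #P := by rw [hQP, card_image_of_injOn hinjP]
  have hinjA : Set.InjOn (fun a : Finset α => U \ a) ↑A := by
    intro p hp q hq hpq
    have h1 := congrArg (fun t => U \ t) hpq
    simp only [hcc p (hAU p (mem_coe.mp hp)), hcc q (hAU q (mem_coe.mp hq))] at h1
    exact h1
  have hcardAc : #Ac = #A := by rw [hAc_def, card_image_of_injOn hinjA]
  -- N(A ∪ Ac) = P ∪ Q and N(A ∩ Ac) ⊆ P ∩ Q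
  have hunion : (A ∪ Ac).biUnion (candidates 𝒟 x) = P ∪ Q := union_biUnion
  have hinter : (A ∩ Ac).biUnion (candidates 𝒟 x) ⊆ P ∩ Q := by
    intro p hp
    obtain ⟨a, ha, hpa⟩ := mem_biUnion.mp hp
    rw [mem_inter] at ha ⊢
    exact ⟨mem_biUnion.mpr ⟨a, ha.1, hpa⟩, mem_biUnion.mpr ⟨a, ha.2, hpa⟩⟩
  rw [hunion] at h₁
  have h₂' : #(A ∩ Ac) ≤ #(P ∩ Q) := h₂.trans (card_le_card hinter)
  have hPQ : #(P ∪ Q) + #(P ∩ Q) = #P + #Q := card_union_add_card_inter P Q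
  have hAA : #(A ∪ Ac) + #(A ∩ Ac) = #A + #Ac := card_union_add_card_inter A Ac
  show #A ≤ #P
  omega

/-- **(MATCH) ⟺ Hall's condition for complement-closed dead sets.** -/
theorem matchHall_iff_complClosed (hU : ∀ a ∈ 𝒟, a ⊆ U) (hco : ∀ a ∈ 𝒟, U \ a ∈ 𝒟)
    (hanti : ∀ a ∈ 𝒟, x (U \ a) = x a + 3) :
    MatchHall U 𝒟 x ↔
      ∀ A ⊆ dead U 𝒟 x, (∀ a ∈ A, U \ a ∈ A) → #A ≤ #(A.biUnion (candidates 𝒟 x)) :=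
  ⟨fun hM A hA _ => hM A hA, matchHall_of_complClosed hU hco hanti⟩

/-- For a complement-closed dead family the neighbourhood is `(all far products with a factor in A) \ 𝒟`; so (MATCH) says that
**every complement-closed family `A` of dead members has at least `#A` absent far products** ('relative Δ-HEX'). -/
theorem matchHall_iff_card_le_card_farProducts_sdiff (hU : ∀ a ∈ 𝒟, a ⊆ U) (hco : ∀ a ∈ 𝒟, U \ a ∈ 𝒟)
    (hanti : ∀ a ∈ 𝒟, x (U \ a) = x a + 3) :
    MatchHall U 𝒟 x ↔
      ∀ A ⊆ dead U 𝒟 x, (∀ a ∈ A, U \ a ∈ A) → #A ≤ #(A.biUnion (farProducts 𝒟 x) \ 𝒟) := by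
  have key : ∀ A : Finset (Finset α), A.biUnion (candidates 𝒟 x) = A.biUnion (farProducts 𝒟 x) \ 𝒟 := by
    intro A
    ext p
    simp only [mem_biUnion, mem_sdiff, candidates]
    constructor
    · rintro ⟨a, ha, hp, hpD⟩; exact ⟨⟨a, ha, hp⟩, hpD⟩
    · rintro ⟨⟨a, ha, hp⟩, hpD⟩; exact ⟨a, ha, hp, hpD⟩
  rw [matchHall_iff_complClosed hU hco hanti]
  constructor
  · intro h A hA hcl; rw [← key]; exact h A hA hcl
  · intro h A hA hcl; rw [key]; exact h A hA hcl

end ComplementSymmetry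

section TwoAxes

/-- Label bookkeeping for two adjacent axes: a label in `{i, i+1, i+3, i+4}` close to one of `i, i+1` is in `{i, i+1}`, hence close to both. -/
theorem close_of_twoAxes {i s t u : ZMod 6} (hs : s = i ∨ s = i + 1) (ht : t = i ∨ t = i + 1)
    (hu : u = i ∨ u = i + 1 ∨ u = i + 3 ∨ u = i + 4) (hus : Close u s) : Close u t := by
  revert i s t u; decide

/-- Labels in `{i, i+1}` are far from labels in `{i+3, i+4}`. -/
theorem not_close_add_three_of_twoAxes {i s t : ZMod 6} (hs : s = i ∨ s = i + 1) (ht : t = i ∨ t = i + 1) :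
    ¬ Close s (t + 3) := by
  revert i s t; decide

/-- **Two adjacent axes: same-half differences of dead members are candidates.**  If all labels lie in `{i, i+1, i+3, i+4}` and `b, b'`
are dead with labels in `{i, i+1}`, then `b \ b'` and `U \ (b' \ b)` are candidates of `b`. -/
theorem sdiff_mem_candidates_of_twoAxes (hU : ∀ a ∈ 𝒟, a ⊆ U) (hco : ∀ a ∈ 𝒟, U \ a ∈ 𝒟)
    (hanti : ∀ a ∈ 𝒟, x (U \ a) = x a + 3) {i : ZMod 6}
    (hlab : ∀ a ∈ 𝒟, x a = i ∨ x a = i + 1 ∨ x a = i + 3 ∨ x a = i + 4)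
    {b b' : Finset α} (hb : b ∈ dead U 𝒟 x) (hb' : b' ∈ dead U 𝒟 x)
    (hxb : x b = i ∨ x b = i + 1) (hxb' : x b' = i ∨ x b' = i + 1) :
    b \ b' ∈ candidates 𝒟 x b ∧ U \ (b' \ b) ∈ candidates 𝒟 x b := by
  have hbD : b ∈ 𝒟 := (mem_filter.mp hb).1
  have hb'D : b' ∈ 𝒟 := (mem_filter.mp hb').1
  have hbdead : b ∉ symGen U 𝒟 x := (mem_filter.mp hb).2
  have hb'dead : b' ∉ symGen U 𝒟 x := (mem_filter.mp hb').2
  -- U \ b' is far from b, and U \ b is far from b'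
  have hfar : ¬ Close (x b) (x (U \ b')) := by
    rw [hanti b' hb'D]; exact not_close_add_three_of_twoAxes hxb hxb'
  -- no member equals b \ b' (it would be close to x b, hence close to x b', contradicting deadness of b')
  have key : ∀ {c c' : Finset α}, c ∈ 𝒟 → c' ∈ 𝒟 → c ∉ symGen U 𝒟 x → c' ∉ symGen U 𝒟 x →
      (x c = i ∨ x c = i + 1) → (x c' = i ∨ x c' = i + 1) → c \ c' ∉ 𝒟 := by
    intro c c' hc hc' hcd hc'd hxc hxc' hmem
    by_cases hcl : Close (x (c \ c')) (x c)
    · have hcl' : Close (x (c \ c')) (x c') := close_of_twoAxes hxc hxc' (hlab _ hmem) hcl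
      exact hc'd (mem_symGen_of_disjoint_close hc' hmem disjoint_sdiff_self_right ((close_comm _ _).mp hcl'))
    · exact hcd (mem_symGen_of_subset_far hU hco hanti hc hmem sdiff_subset hcl)
  -- c \ c' = c ∩ (U \ c') for members
  have hsd : ∀ {c c' : Finset α}, c ∈ 𝒟 → c' ∈ 𝒟 → c \ c' = c ∩ (U \ c') := by
    intro c c' hc hc'
    have h1 := sdiff_univ_compl_eq_inter (U := U) (f := U \ c') (hU c hc)
    rw [Finset.sdiff_sdiff_eq_self (hU c' hc')] at h1
    exact h1
  unfold candidates
  constructor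
  · rw [mem_sdiff]
    exact ⟨mem_farProducts.mpr ⟨U \ b', hco b' hb'D, hfar, Or.inl (hsd hbD hb'D)⟩, key hbD hb'D hbdead hb'dead hxb hxb'⟩
  · rw [mem_sdiff]
    refine ⟨mem_farProducts.mpr ⟨U \ b', hco b' hb'D, hfar, Or.inr ?_⟩, fun hmem => ?_⟩
    · rw [union_comm, compl_union_eq_compl_sdiff_inter b' (hU b hbD), ← hsd hb'D hbD]
    · have h1 := hco _ hmem
      rw [Finset.sdiff_sdiff_eq_self (sdiff_subset.trans (hU b' hb'D))] at h1
      exact key hb'D hbD hb'dead hbdead hxb' hxb h1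

/-- **(MATCH) for two adjacent axes.**  If all labels of the antipodal instance lie in `{i, i+1, i+3, i+4}`, Conjecture (MATCH) holds:
for a complement-closed dead family `A` with half `B = {a ∈ A : x a ∈ {i, i+1}}` the candidates contain `B \\ B` and its complements,
which number at least `2 #B = #A` by Δ-MS (`two_mul_card_le_card_cl_diffs`). -/
theorem matchHall_of_adjacent (hU : ∀ a ∈ 𝒟, a ⊆ U) (hco : ∀ a ∈ 𝒟, U \ a ∈ 𝒟)
    (hanti : ∀ a ∈ 𝒟, x (U \ a) = x a + 3) (i : ZMod 6)
    (hlab : ∀ a ∈ 𝒟, x a = i ∨ x a = i + 1 ∨ x a = i + 3 ∨ x a = i + 4) : MatchHall U 𝒟 x := by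
  classical
  refine matchHall_of_complClosed hU hco hanti fun A hA hcl => ?_
  have hAD : ∀ a ∈ A, a ∈ 𝒟 := fun a ha => (mem_filter.mp (show a ∈ dead U 𝒟 x from hA ha)).1
  set B : Finset (Finset α) := A.filter fun a => x a = i ∨ x a = i + 1 with hB_def
  have hBA : B ⊆ A := filter_subset _ _
  have hBU : ∀ f ∈ B, f ⊆ U := fun f hf => hU f (hAD f (hBA hf))
  -- B is complement-free
  have keylab : ∀ j s : ZMod 6, (s = j ∨ s = j + 1) → ¬ (s + 3 = j ∨ s + 3 = j + 1) := by decide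
  have keylab' : ∀ j s : ZMod 6, (s = j + 3 ∨ s = j + 4) → (s + 3 = j ∨ s + 3 = j + 1) := by decide
  have hfree : ∀ f ∈ B, U \ f ∉ B := by
    intro f hf hcf
    rw [hB_def, mem_filter] at hf hcf
    have h1 := hcf.2
    rw [hanti f (hAD f hf.1)] at h1
    exact keylab i (x f) hf.2 h1
  -- #A = 2 #B : A \ B is the complement image of B
  have hcc : ∀ a : Finset α, a ⊆ U → U \ (U \ a) = a := fun a ha => Finset.sdiff_sdiff_eq_self ha
  have himg : A \ B = B.image fun f => U \ f := by
    ext a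
    rw [mem_sdiff, mem_image]
    constructor
    · rintro ⟨haA, haB⟩
      have hna : ¬ (x a = i ∨ x a = i + 1) := fun h => haB (by rw [hB_def, mem_filter]; exact ⟨haA, h⟩)
      have hxa : x a = i + 3 ∨ x a = i + 4 := by
        rcases hlab a (hAD a haA) with h | h | h | h
        · exact absurd (Or.inl h) hna
        · exact absurd (Or.inr h) hna
        · exact Or.inl h
        · exact Or.inr h
      refine ⟨U \ a, ?_, hcc a (hU a (hAD a haA))⟩
      rw [hB_def, mem_filter]
      refine ⟨hcl a haA, ?_⟩
      rw [hanti a (hAD a haA)]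
      exact keylab' i (x a) hxa
    · rintro ⟨f, hf, rfl⟩
      refine ⟨hcl f (hBA hf), fun h => hfree f hf h⟩
  have hinjB : Set.InjOn (fun f : Finset α => U \ f) ↑B := by
    intro p hp q hq hpq
    have h1 := congrArg (fun t => U \ t) hpq
    simp only [hcc p (hBU p (mem_coe.mp hp)), hcc q (hBU q (mem_coe.mp hq))] at h1
    exact h1
  have hcardA : #A = 2 * #B := by
    have h1 : #(A \ B) + #B = #A := card_sdiff_add_card_eq_card hBA
    rw [himg, card_image_of_injOn hinjB] at h1
    omega
  -- the differences B \\ B and their complements are candidates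
  have hsub : (B \\ B) ∪ (B \\ B).image (fun z => U \ z) ⊆ A.biUnion (candidates 𝒟 x) := by
    intro p hp
    rw [mem_union, mem_image] at hp
    rcases hp with hp | ⟨q, hq, rfl⟩
    · rw [Finset.mem_diffs] at hp
      obtain ⟨b, hb, b', hb', rfl⟩ := hp
      rw [hB_def, mem_filter] at hb hb'
      exact mem_biUnion.mpr ⟨b, hb.1,
        (sdiff_mem_candidates_of_twoAxes hU hco hanti hlab (hA hb.1) (hA hb'.1) hb.2 hb'.2).1⟩
    · rw [Finset.mem_diffs] at hq
      obtain ⟨b', hb', b, hb, rfl⟩ := hq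
      rw [hB_def, mem_filter] at hb hb'
      exact mem_biUnion.mpr ⟨b, hb.1,
        (sdiff_mem_candidates_of_twoAxes hU hco hanti hlab (hA hb.1) (hA hb'.1) hb.2 hb'.2).2⟩
  have hMS := two_mul_card_le_card_cl_diffs U B hBU hfree
  rw [hcardA]
  exact hMS.trans (card_le_card hsub)

end TwoAxes

end GeneratedDonors

end Summit.CriticalPhenomena.PercolationContinuityZ3.Theorems
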